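import Literature.NumberTheory.DiophantineGeometry.GenEllValuationMultiplicity
import Mathlib.NumberTheory.RamificationInertia.Valuation
import Mathlib.NumberTheory.NumberField.Basic
import Mathlib.FieldTheory.SplittingField.Construction
import Mathlib.RingTheory.DedekindDomain.IntegralClosure
import Mathlib.RingTheory.Ideal.Norm.AbsNorm
import Mathlib.RingTheory.Polynomial.Tower
import HarnessLib

/-!
# Good-prime multiplicity inequality — number fields: the finite exceptional modulus

Support file for the number-field route to [GenEll] Thm. 2.1 (ii) ⟹ (i) (`GenEllTwo`,
route-ABC-IUTThetaPilot; S. Mochizuki, *Arithmetic elliptic curves in general position*,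
Math. J. Okayama Univ. 52 (2010) [cite: MochizukiGenEll2010], Prop. 1.6 p. 10 / Thm. 2.1
pp. 11–13; architecture note abc-iut-S6 `GENELLTWO-P1ROUTE.md` §3 (d) "off a finite set of
primes … `1 ≤ ord⁺_w(t(P) − b) − ord⁺_w N(P)`").

The local lemma (abc-iut-w5-d045, `GenEllValuationMultiplicity.lean`:
`GenEll.valuation_eval_lt_valuation_eval_derivative` — over any valued field, a split polynomial with
unit leading coefficient, integral pairwise-separated roots and unit multiplicities satisfies
`v(g(ρ)) < 1`, `g(ρ) ≠ 0` ⇒ `v(g(ρ)) < v(g′(ρ))`) needs, at the place `w`, four "good reduction"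
hypotheses on the polynomial. This file proves that for a FIXED nonzero
polynomial `f` over a number field `K` they hold at every finite place `w` of EVERY number field
`M ⊇ K` splitting `f`, as soon as `w` does not divide one natural number `D = D(f) > 0`
(`exists_modulus_goodReduction`), and deduces the user-facing statement over an ARBITRARY number
field `L ⊇ K` (no splitting assumption):

> `∃ D > 0, ∀ L ⊇ K, ∀ w ∤ D, ∀ ρ ∈ L` `w`-integral with `f(ρ) ≠ 0`, `w(f(ρ)) < 1`:
> `w(f(ρ)) < w(f′(ρ))` (`exists_modulus_val_aeval_lt_val_aeval_derivative`),

i.e. `ord_w f′(ρ) ≤ ord_w f(ρ) − 1`: the SHARP multiplicity count behind "conductor ≤ height"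
[cite: MochizukiGenEll2010, Prop 1.6 p.10] in the explicit route. The descent from a splitting
field `M ⊇ L` to `L` uses `w′|_L = w^{e(w′|w)}` (Mathlib `valuation_liesOver`); strictness of the
inequality survives any ramification index, so no unramifiedness bookkeeping is needed.
(Universe convention: the base field `K` and the test fields `L`, `M` live in one universe `u`, so
that the existential modulus can be opened with `obtain` without universe metavariables.)
Theorems only; no definitions. Classical; nothing here touches [IUTchIII].
-/

noncomputable section

open Polynomial NumberField IsDedekindDomain

universe u

namespace Literature.NumberTheory.DiophantineGeometry.GoodPrime

/-! ## Valuation bookkeeping in number fields -/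

section Bookkeeping

variable {M : Type*} [Field M] [NumberField M] (w : HeightOneSpectrum (𝓞 M))

/-- In a linearly ordered group with zero, if `a, b ≤ 1` and `a·b = 1` then `a = 1`. [folklore] -/
private theorem eq_one_of_mul_eq_one {Γ₀ : Type*} [LinearOrderedCommGroupWithZero Γ₀] {a b : Γ₀}
    (ha : a ≤ 1) (hb : b ≤ 1) (h : a * b = 1) : a = 1 :=
  le_antisymm ha (by
    calc (1 : Γ₀) = a * b := h.symm
      _ ≤ a * 1 := mul_le_mul' le_rfl hb
      _ = a := mul_one a)

/-- `ℤ`-integral elements of a number field have `w`-adic valuation `≤ 1`. [folklore] -/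
private theorem val_le_one_of_isIntegral {x : M} (hx : IsIntegral ℤ x) : w.valuation M x ≤ 1 := by
  have h := w.valuation_le_one (K := M) (⟨x, hx⟩ : 𝓞 M)
  simpa using h

/-- Natural numbers have `w`-adic valuation `≤ 1`. [folklore] -/
private theorem val_natCast_le (n : ℕ) : w.valuation M (n : M) ≤ 1 := by
  have h := val_le_one_of_isIntegral w (isIntegral_algebraMap (R := ℤ) (A := M) (x := (n : ℤ)))
  simpa using h

/-- If `w ∤ D` (i.e. `w(D) = 1`) and `d ∣ D` then `w(d) = 1`. [folklore] -/
private theorem val_natCast_eq_one_of_dvd {d D : ℕ} (hd : d ∣ D) (hD : w.valuation M (D : M) = 1) :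
    w.valuation M (d : M) = 1 := by
  obtain ⟨k, rfl⟩ := hd
  rw [Nat.cast_mul, map_mul] at hD
  exact eq_one_of_mul_eq_one (val_natCast_le w d) (val_natCast_le w k) hD

/-- If `w(D) = 1` and `|y| ∣ D` for an integer `y` then `w(y) = 1`. [folklore] -/
private theorem val_intCast_eq_one_of_dvd {y : ℤ} {D : ℕ} (hd : y.natAbs ∣ D)
    (hD : w.valuation M (D : M) = 1) : w.valuation M (y : M) = 1 := by
  have h := val_natCast_eq_one_of_dvd w hd hD
  obtain ⟨n, rfl | rfl⟩ := Int.eq_nat_or_neg y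
  · simpa using h
  · simp only [Int.natAbs_neg, Int.natAbs_natCast] at h
    simpa [Valuation.map_neg] using h

/-- **Norm trick.** If `y` is an algebraic integer of a number field `K₁`, `ι : K₁ → M` a field
homomorphism and `w` a place of `M` not dividing the norm `N(y)` (i.e. `w(N(y)) = 1`), then `ι y`
is a `w`-unit: indeed `N(y) = y · z` with `z` integral. [folklore] -/
private theorem val_eq_one_of_val_absNorm {K₁ : Type*} [Field K₁] [NumberField K₁] (ι : K₁ →+* M)
    (y : 𝓞 K₁) (hN : w.valuation M (Ideal.absNorm (Ideal.span {y}) : M) = 1) :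
    w.valuation M (ι y) = 1 := by
  obtain ⟨z, hz⟩ : ∃ z : 𝓞 K₁, z * y = (Ideal.absNorm (Ideal.span {y}) : 𝓞 K₁) :=
    Ideal.mem_span_singleton'.mp (Ideal.absNorm_mem _)
  have hzK : ((z : K₁)) * (y : K₁) = (Ideal.absNorm (Ideal.span {y}) : K₁) := by
    have := congrArg (algebraMap (𝓞 K₁) K₁) hz
    simpa using this
  have hzM : ι z * ι y = (Ideal.absNorm (Ideal.span {y}) : M) := by
    rw [← map_mul, hzK, map_natCast]
  have hy1 : w.valuation M (ι y) ≤ 1 :=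
    val_le_one_of_isIntegral w ((RingOfIntegers.isIntegral_coe y).map ι.toIntAlgHom)
  have hz1 : w.valuation M (ι z) ≤ 1 :=
    val_le_one_of_isIntegral w ((RingOfIntegers.isIntegral_coe z).map ι.toIntAlgHom)
  rw [← hzM, map_mul, mul_comm] at hN
  exact eq_one_of_mul_eq_one hy1 hz1 hN

end Bookkeeping

/-! ## Good reduction off a finite modulus (integral coefficients, split extension) -/

/-- **Finite exceptional modulus.** Let `f` be a nonzero polynomial over a number field `K`
(arbitrary coefficients). There is a natural number `D > 0` such that for every number field
`M ⊇ K` in which `f` splits and every finite place `w` of `M` with `w(D) = 1`: the coefficients of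
`f` are `w`-integral, its leading coefficient is a `w`-unit, distinct roots have `w`-unit
differences, and every root multiplicity is a `w`-unit — the hypotheses of the local lemma
`GenEll.valuation_eval_lt_valuation_eval_derivative` (root integrality follows from the first two
via `GenEll.valuation_le_one_of_isRoot`). (`D = |y₀|·|y|·N(y₀c)·(deg f)!·∏ N(y(α−β))` for
integers `y₀`, `y` making the coefficients, resp. the roots, integral.)
[cite: MochizukiGenEll2010, Prop 1.6 p.10] -/
theorem exists_modulus_goodReduction {K : Type u} [Field K] [NumberField K] {f : K[X]}
    (hf : f ≠ 0) :
    ∃ D : ℕ, 0 < D ∧ ∀ (M : Type u) [Field M] [NumberField M] [Algebra K M],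
      (f.map (algebraMap K M)).Splits → ∀ w : HeightOneSpectrum (𝓞 M),
        w.valuation M (D : M) = 1 →
        (∀ n, w.valuation M ((f.map (algebraMap K M)).coeff n) ≤ 1) ∧
        w.valuation M (f.map (algebraMap K M)).leadingCoeff = 1 ∧
        (∀ α ∈ (f.map (algebraMap K M)).roots, ∀ β ∈ (f.map (algebraMap K M)).roots,
          α ≠ β → w.valuation M (α - β) = 1) ∧
        (∀ α ∈ (f.map (algebraMap K M)).roots,
          w.valuation M ((f.map (algebraMap K M)).rootMultiplicity α : M) = 1) := by
  classical
  -- the splitting field of `f` over `K`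
  let K₁ := f.SplittingField
  haveI : NumberField K₁ := NumberField.of_module_finite K K₁
  set f₁ : K₁[X] := f.map (algebraMap K K₁) with hf₁
  have hs₁ : f₁.Splits := SplittingField.splits f
  have hf₁0 : f₁ ≠ 0 := (Polynomial.map_ne_zero_iff (algebraMap K K₁).injective).mpr hf
  -- integers making every coefficient, resp. every root, integral
  obtain ⟨y₀, hy₀0, hy₀⟩ := exists_integral_multiples ℤ ℚ f.coeffs
  have hint : ∀ n, IsIntegral ℤ ((y₀ : K) * f.coeff n) := by
    intro n
    by_cases hn : f.coeff n = 0
    · rw [hn, mul_zero]; exact isIntegral_zero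
    · simpa [zsmul_eq_mul] using hy₀ (f.coeff n) (coeff_mem_coeffs hn)
  obtain ⟨y, hy0, hy⟩ := exists_integral_multiples ℤ ℚ f₁.roots.toFinset
  -- the (scaled) leading coefficient, as an algebraic integer of `K₁`
  have hc0 : f.leadingCoeff ≠ 0 := leadingCoeff_ne_zero.mpr hf
  have hc₁int : IsIntegral ℤ (algebraMap K K₁ ((y₀ : K) * f.leadingCoeff)) := (hint _).algebraMap
  let cO : 𝓞 K₁ := ⟨algebraMap K K₁ ((y₀ : K) * f.leadingCoeff), hc₁int⟩
  let Nc : ℕ := Ideal.absNorm (Ideal.span {cO})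
  -- norms of `y·(α − β)` for distinct roots
  let g : K₁ → K₁ → ℕ := fun α β =>
    if h : α ≠ β ∧ IsIntegral ℤ ((y : K₁) * α - (y : K₁) * β) then
      Ideal.absNorm (Ideal.span ({⟨(y : K₁) * α - (y : K₁) * β, h.2⟩} : Set (𝓞 K₁))) else 1
  let P : ℕ := ∏ α ∈ f₁.roots.toFinset, ∏ β ∈ f₁.roots.toFinset, g α β
  have hNc : Nc ≠ 0 := by
    intro h0
    rw [Ideal.absNorm_eq_zero_iff, Ideal.span_singleton_eq_bot] at h0
    have h1 : algebraMap K K₁ ((y₀ : K) * f.leadingCoeff) = 0 := by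
      change (cO : K₁) = 0
      rw [h0]; exact map_zero _
    rw [map_eq_zero_iff _ (algebraMap K K₁).injective, mul_eq_zero] at h1
    rcases h1 with h1 | h1
    · exact hy₀0 (by exact_mod_cast h1)
    · exact hc0 h1
  have hg : ∀ α β, g α β ≠ 0 := by
    intro α β
    simp only [g]
    split_ifs with h
    · intro h0
      rw [Ideal.absNorm_eq_zero_iff, Ideal.span_singleton_eq_bot] at h0
      have h0' : (y : K₁) * α - (y : K₁) * β = 0 := by
        have := congrArg (fun z : 𝓞 K₁ => (z : K₁)) h0
        simpa using this
      rw [← mul_sub, mul_eq_zero, sub_eq_zero] at h0'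
      rcases h0' with h1 | h1
      · exact hy0 (by exact_mod_cast h1)
      · exact h.1 h1
    · exact one_ne_zero
  have hP : P ≠ 0 := Finset.prod_ne_zero_iff.mpr fun α _ =>
    Finset.prod_ne_zero_iff.mpr fun β _ => hg α β
  refine ⟨y₀.natAbs * (y.natAbs * Nc * f.natDegree.factorial * P), ?_, ?_⟩
  · have : y.natAbs ≠ 0 := Int.natAbs_ne_zero.mpr hy0
    have : y₀.natAbs ≠ 0 := Int.natAbs_ne_zero.mpr hy₀0
    positivity
  intro M _ _ _ hsM w hD₀
  -- unpack the divisibility conditions hidden in `w(D) = 1`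
  have hDy₀ : w.valuation M (y₀ : M) = 1 := val_intCast_eq_one_of_dvd w (Dvd.intro _ rfl) hD₀
  have hD : w.valuation M ((y.natAbs * Nc * f.natDegree.factorial * P : ℕ) : M) = 1 :=
    val_natCast_eq_one_of_dvd w (Dvd.intro_left _ rfl) hD₀
  have hfact_dvd : f.natDegree.factorial ∣ y.natAbs * Nc * f.natDegree.factorial * P :=
    (Dvd.intro_left (y.natAbs * Nc) rfl).trans (Dvd.intro P rfl)
  have hDy : w.valuation M (y : M) = 1 :=
    val_intCast_eq_one_of_dvd w (Dvd.intro (Nc * f.natDegree.factorial * P) (by ring)) hD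
  have hDNc : w.valuation M (Nc : M) = 1 :=
    val_natCast_eq_one_of_dvd w (Dvd.intro (y.natAbs * f.natDegree.factorial * P) (by ring)) hD
  have hDP : w.valuation M (P : M) = 1 :=
    val_natCast_eq_one_of_dvd w (Dvd.intro_left _ rfl) hD
  -- scaling by the `w`-unit `y₀` does not change valuations
  have hscale : ∀ x : K, w.valuation M (algebraMap K M ((y₀ : K) * x)) =
      w.valuation M (algebraMap K M x) := by
    intro x
    rw [map_mul, map_intCast, map_mul, hDy₀, one_mul]
  -- compare with the splitting field `K₁`
  let ι : K₁ →ₐ[K] M := SplittingField.lift f hsM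
  have hfM : f.map (algebraMap K M) = f₁.map (ι : K₁ →+* M) := by
    rw [hf₁, Polynomial.map_map, AlgHom.comp_algebraMap]
  have hrootsM : (f.map (algebraMap K M)).roots = f₁.roots.map (ι : K₁ →+* M) := by
    rw [hfM]; exact hs₁.roots_map _
  refine ⟨?_, ?_, ?_, ?_⟩
  · -- (i) integral coefficients (off the denominators collected in `y₀`)
    intro n
    rw [coeff_map, ← hscale]
    exact val_le_one_of_isIntegral w (hint n).algebraMap
  · -- (ii) unit leading coefficient
    rw [leadingCoeff_map_of_injective (algebraMap K M).injective, ← hscale, ← ι.commutes]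
    exact val_eq_one_of_val_absNorm w (ι : K₁ →+* M) cO hDNc
  · -- (iii) distinct roots have unit differences
    intro α' hα' β' hβ' hne
    rw [hrootsM] at hα' hβ'
    obtain ⟨α, hα, rfl⟩ := Multiset.mem_map.mp hα'
    obtain ⟨β, hβ, rfl⟩ := Multiset.mem_map.mp hβ'
    have hαβ : α ≠ β := fun h => hne (by rw [h])
    have hαi : IsIntegral ℤ ((y : K₁) * α) := by
      simpa [zsmul_eq_mul] using hy α (Multiset.mem_toFinset.mpr hα)
    have hβi : IsIntegral ℤ ((y : K₁) * β) := by
      simpa [zsmul_eq_mul] using hy β (Multiset.mem_toFinset.mpr hβ)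
    have hδi : IsIntegral ℤ ((y : K₁) * α - (y : K₁) * β) := hαi.sub hβi
    let δO : 𝓞 K₁ := ⟨(y : K₁) * α - (y : K₁) * β, hδi⟩
    have hgαβ : g α β = Ideal.absNorm (Ideal.span {δO}) := by
      simp only [g, dif_pos (show α ≠ β ∧ _ from ⟨hαβ, hδi⟩)]
      rfl
    have hg_dvd : g α β ∣ P :=
      (Finset.dvd_prod_of_mem _ (Multiset.mem_toFinset.mpr hβ)).trans
        (Finset.dvd_prod_of_mem _ (Multiset.mem_toFinset.mpr hα))
    have hval : w.valuation M (Ideal.absNorm (Ideal.span {δO}) : M) = 1 := by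
      rw [← hgαβ]; exact val_natCast_eq_one_of_dvd w hg_dvd hDP
    have hδ : w.valuation M ((ι : K₁ →+* M) δO) = 1 := val_eq_one_of_val_absNorm w _ δO hval
    have hδ' : ((ι : K₁ →+* M) δO) = (y : M) * ((ι : K₁ →+* M) α - (ι : K₁ →+* M) β) := by
      show (ι : K₁ →+* M) ((y : K₁) * α - (y : K₁) * β) = _
      rw [map_sub, map_mul, map_mul, map_intCast, mul_sub]
    rw [hδ', map_mul, hDy, one_mul] at hδ
    exact hδ
  · -- (iv) root multiplicities are units (they divide `(deg f)!`)
    intro α hα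
    have hmap0 : f.map (algebraMap K M) ≠ 0 :=
      (Polynomial.map_ne_zero_iff (algebraMap K M).injective).mpr hf
    have hm0 : 0 < (f.map (algebraMap K M)).rootMultiplicity α :=
      (rootMultiplicity_pos hmap0).mpr ((mem_roots hmap0).mp hα)
    have hmle : (f.map (algebraMap K M)).rootMultiplicity α ≤ f.natDegree := by
      calc (f.map (algebraMap K M)).rootMultiplicity α
          = (f.map (algebraMap K M)).roots.count α := (count_roots _).symm
        _ ≤ (f.map (algebraMap K M)).roots.card := Multiset.count_le_card _ _
        _ ≤ (f.map (algebraMap K M)).natDegree := card_roots' _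
        _ = f.natDegree := natDegree_map_eq_of_injective (algebraMap K M).injective f
    exact val_natCast_eq_one_of_dvd w ((Nat.dvd_factorial hm0 hmle).trans hfact_dvd) hD

/-! ## The user-facing statement: arbitrary number field, arbitrary coefficients -/

/-- **Good-prime multiplicity inequality (number fields).** Let `f` be a nonzero polynomial over a
number field `K`. There is a natural number `D > 0` such that for every number field `L ⊇ K`,
every finite place `w` of `L` not dividing `D` (`w(D) = 1`) and every `w`-integral `ρ ∈ L` with
`f(ρ) ≠ 0` and `f(ρ) ≡ 0 (mod w)`: `w(f(ρ)) < w(f′(ρ))`, i.e. `ord_w f′(ρ) ≤ ord_w f(ρ) − 1`.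
Applied to `f = G(·, b)` (the plane model of `D_e` specialised at `t = b`) this is the local
inequality `1 ≤ ord⁺_w(t(P) − b) − ord⁺_w N(P)` of the explicit route to [GenEll] Thm. 2.1
(abc-iut-S6 `GENELLTWO-P1ROUTE` §3 (d)). [cite: MochizukiGenEll2010, Prop 1.6 p.10] -/
theorem exists_modulus_val_aeval_lt_val_aeval_derivative {K : Type u} [Field K] [NumberField K]
    {f : K[X]} (hf : f ≠ 0) :
    ∃ D : ℕ, 0 < D ∧ ∀ (L : Type u) [Field L] [NumberField L] [Algebra K L]
      (w : HeightOneSpectrum (𝓞 L)) (ρ : L), w.valuation L (D : L) = 1 → w.valuation L ρ ≤ 1 →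
      aeval ρ f ≠ 0 → w.valuation L (aeval ρ f) < 1 →
      w.valuation L (aeval ρ f) < w.valuation L (aeval ρ (derivative f)) := by
  classical
  obtain ⟨D, hD0, hgood⟩ := exists_modulus_goodReduction hf
  refine ⟨D, hD0, ?_⟩
  intro L _ _ _ w ρ hD hρ hfρ0 hfρ
  -- Step 1: a splitting field `M` of `f` over `L`, a place `w′ | w`
  let M := (f.map (algebraMap K L)).SplittingField
  haveI : NumberField M := NumberField.of_module_finite L M
  have hsM : (f.map (algebraMap K M)).Splits := by
    rw [IsScalarTower.algebraMap_eq K L M, ← Polynomial.map_map]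
    exact SplittingField.splits _
  haveI := w.isMaximal
  obtain ⟨Q, hQmax, hQover⟩ :=
    Ideal.exists_maximal_ideal_liesOver_of_isIntegral (S := 𝓞 M) w.asIdeal
  let w' : HeightOneSpectrum (𝓞 M) :=
    ⟨Q, hQmax.isPrime, Ideal.ne_bot_of_liesOver_of_ne_bot w.ne_bot Q⟩
  haveI : w'.asIdeal.LiesOver w.asIdeal := hQover
  have he : w.asIdeal.ramificationIdx' w'.asIdeal ≠ 0 :=
    Ideal.IsDedekindDomain.ramificationIdx'_ne_zero_of_liesOver w'.asIdeal w.ne_bot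
  have key : ∀ x : L, w'.valuation M (algebraMap L M x) =
      w.valuation L x ^ w.asIdeal.ramificationIdx' w'.asIdeal :=
    fun x => (HeightOneSpectrum.valuation_liesOver M w w' x).symm
  -- Step 2: transport the hypotheses up to `M`
  have hD' : w'.valuation M (D : M) = 1 := by
    rw [← map_natCast (algebraMap L M), key, hD, one_pow]
  obtain ⟨hcoeff, hlead, hsep, hmult⟩ := hgood M hsM w' hD'
  set ρ' : M := algebraMap L M ρ with hρ'_def
  have hρ' : w'.valuation M ρ' ≤ 1 := by
    rw [hρ'_def, key]; exact pow_le_one₀ zero_le hρ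
  have heval : (f.map (algebraMap K M)).eval ρ' = algebraMap L M (aeval ρ f) := by
    rw [eval_map_algebraMap, hρ'_def, aeval_algebraMap_apply]
  have heval' : (f.map (algebraMap K M)).derivative.eval ρ' =
      algebraMap L M (aeval ρ (derivative f)) := by
    rw [derivative_map, eval_map_algebraMap, hρ'_def, aeval_algebraMap_apply]
  have hfρ0' : (f.map (algebraMap K M)).eval ρ' ≠ 0 := by
    rw [heval, map_ne_zero_iff _ (algebraMap L M).injective]
    exact hfρ0
  have hfρ' : w'.valuation M ((f.map (algebraMap K M)).eval ρ') < 1 := by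
    rw [heval, key]
    exact pow_lt_one₀ zero_le hfρ he
  -- Step 3: the local lemma in `M` (abc-iut-w5-d045, `GenEllValuationMultiplicity`), then descend
  have hF0 : f.map (algebraMap K M) ≠ 0 :=
    (Polynomial.map_ne_zero_iff (algebraMap K M).injective).mpr hf
  have hrootsInt : ∀ a ∈ (f.map (algebraMap K M)).roots, w'.valuation M a ≤ 1 := fun a ha =>
    GenEll.valuation_le_one_of_isRoot (w'.valuation M) hcoeff hlead ((mem_roots hF0).mp ha)
  have hM := (GenEll.valuation_eval_lt_valuation_eval_derivative (w'.valuation M) hsM hlead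
    hrootsInt hsep hmult hρ' hfρ0' hfρ').2
  rw [heval, heval', key, key] at hM
  exact lt_of_pow_lt_pow_left₀ _ zero_le hM

/-- **Simultaneous modulus for a finite family.** For finitely many nonzero polynomials over a number
field `K` one natural number `D > 0` works for all of them in
`exists_modulus_val_aeval_lt_val_aeval_derivative` (take the product of the individual moduli) —
the form consumed when the fibre polynomial is specialised at the finitely many points `b ∈ B`.
[cite: MochizukiGenEll2010, Prop 1.6 p.10] -/
theorem exists_modulus_val_aeval_lt_val_aeval_derivative_finset {K : Type u} [Field K]
    [NumberField K] {ι : Type*} (s : Finset ι) (f : ι → K[X]) (hf : ∀ i ∈ s, f i ≠ 0) :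
    ∃ D : ℕ, 0 < D ∧ ∀ i ∈ s, ∀ (L : Type u) [Field L] [NumberField L] [Algebra K L]
      (w : HeightOneSpectrum (𝓞 L)) (ρ : L), w.valuation L (D : L) = 1 → w.valuation L ρ ≤ 1 →
      aeval ρ (f i) ≠ 0 → w.valuation L (aeval ρ (f i)) < 1 →
      w.valuation L (aeval ρ (f i)) < w.valuation L (aeval ρ (derivative (f i))) := by
  classical
  choose! D hD hgood using
    fun i (hi : i ∈ s) => exists_modulus_val_aeval_lt_val_aeval_derivative (hf i hi)
  refine ⟨∏ i ∈ s, D i, Finset.prod_pos fun i hi => hD i hi, ?_⟩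
  intro i hi L _ _ _ w ρ hDw hρ h0 hlt
  exact hgood i hi L w ρ (val_natCast_eq_one_of_dvd w (Finset.dvd_prod_of_mem _ hi) hDw) hρ h0 hlt

end Literature.NumberTheory.DiophantineGeometry.GoodPrime

end
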